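import Mathlib
import Literature.AlgebraicGeometry.Resolution.LocalBlowup
import Literature.AlgebraicGeometry.Resolution.LocalUniformization
import Literature.AlgebraicGeometry.Resolution.CentreLocalRingLemmas
import Literature.AlgebraicGeometry.Resolution.RankOneReductionProofs
import Literature.RingTheory.KrullDimension.AffineCatenary
import Summits.ResolutionOfSingularities.ResolutionOfSingularities.Theorems.HomologicalConductorGlobalisationLocEq
import Summits.ResolutionOfSingularities.ResolutionOfSingularities.Theorems.HomologicalConductorStrictDropTowerDimAntitone
import Summits.ResolutionOfSingularities.ResolutionOfSingularities.Theorems.HomologicalConductorNoZenoTowerGroundChange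
import Summits.ResolutionOfSingularities.ResolutionOfSingularities.Theorems.HomologicalConductorNoZenoRebase
import Summits.ResolutionOfSingularities.ResolutionOfSingularities.Theorems.HomologicalConductorStrictDropReground
import Summits.ResolutionOfSingularities.ResolutionOfSingularities.Theorems.HomologicalConductorNoZenoIffKernel
import HarnessLib

/-!
# RE-GROUNDING IN EVERY DIMENSION: a stage of Krull dimension `h` of the canonical tower is the localised
# finitely generated model of an `F`-datum of dimension `h` (`k ⊆ F ⊆ K` purely transcendental), with the SAME tower

Route `ResolutionOfSingularities/HomologicalConductor`, cruxes `StrictDrop` (stmt-16485), `NoZenoR` (stmt-19943), kill test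
`SurfaceTermination` (stmt-16488); Birth vocabulary.  OURS (cell decomp-res, hand leafhand-res-homologicalconduct-3);
AI-written support lemma, weaker than expert review; nothing here is a statement of any manuscript under review.
SUPPORT-level; no stub, crux, route or summit statement is proved here.

* `exists_reground` — for every admissible datum `(k, K, O, A)` and stage `m₀` with `ringKrullDim T_(m₀) = h`:
  there are an intermediate field `k ⊆ F ⊆ K` with `F ⊆ O` and a finitely generated `F`-subalgebra `A' ⊆ O` with
  `Frac A' = K`, `ringKrullDim A' = h`, whose canonical tower over `F` IS the tower of `A` from `m₀` on (same
  underlying rings, same regularity), stage by stage.  This is the dimension-`h` form of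
  `Reground.exists_isRegularLocalRing_tower_of_ringKrullDim_eq_two` (p800194; same proof: lifted transcendence basis
  of the residue ring of the centre, `trdeg_add_eq`, affine dimension formula, `GroundChange.tower_toSubring_eq`,
  `NoZeno.Birth.tower_tower`).  Use: every statement about TERMINATION of towers quantified over all ground fields
  reduces to data whose tower keeps the TOP dimension `dim A` (all centres closed points) — see
  `HomologicalConductorNoZenoRHighDimDoor`.

References (mechanism only): H. Matsumura, *Commutative Ring Theory*, Thm. 5.6 [`Matsumura1987`].
-/

noncomputable section

-- single-problem summit: the doubled namespace component `ResolutionOfSingularities` is forced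
set_option linter.dupNamespace false

open IsLocalRing
open Literature.AlgebraicGeometry.Resolution

open Summit.ResolutionOfSingularities.ResolutionOfSingularities.Theorems.HomologicalConductorGlobalisation (stub_locEq)

namespace Summit.ResolutionOfSingularities.ResolutionOfSingularities.Theorems.NoZeno.Birth.Reground

variable {k K : Type} [Field k] [Field K] [Algebra k K]

/-- **Re-grounding in dimension `h`.**  For an admissible datum and a stage `T_(m₀)` of Krull dimension `h`: an
intermediate field `k ⊆ F ⊆ K` inside `O` and a finitely generated `F`-subalgebra `A' ⊆ O` with `Frac A' = K` and
`ringKrullDim A' = h` whose `F`-tower has, stage by stage, the same underlying rings (hence the same regularity) as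
the `k`-tower of `A` from `m₀` on. [cite: Matsumura1987, Thm. 5.6] [folklore] -/
theorem exists_reground (O : ValuationSubring K) (A : Subalgebra k K) (hk : ∀ c : k, algebraMap k K c ∈ O)
    (hA : A.FG) (hfr : IsFractionRing ↥A K) (hAO : A.toSubring ≤ O.toSubring) (m₀ : ℕ) {h : ℕ}
    (hdim : ringKrullDim ↥(tower O A m₀) = h) :
    ∃ (F : IntermediateField k K) (A' : Subalgebra ↥F K), (∀ c : ↥F, algebraMap (↥F) K c ∈ O) ∧ A'.FG ∧
      IsFractionRing ↥A' K ∧ A'.toSubring ≤ O.toSubring ∧ ringKrullDim ↥A' = h ∧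
      ∀ n : ℕ, (tower O A (m₀ + n)).toSubring = (tower O A' n).toSubring ∧
        (IsRegularLocalRing ↥(tower O A (m₀ + n)) ↔ IsRegularLocalRing ↥(tower O A' n)) := by
  classical
  haveI := hfr
  -- (1) a finitely generated model `Am` of the stage `T := T_(m₀)`
  obtain ⟨Am, hAmfg, hAAm, hAmO, hT⟩ := exists_fg_model_tower O A hA hfr hAO m₀
  haveI : Algebra.FiniteType k ↥Am := Am.fg_iff_finiteType.mp hAmfg
  haveI : IsFractionRing ↥Am K := isFractionRing_subalgebra_of_le A Am hAAm
  have hAmT : Am ≤ tower O A m₀ := fun x hx => by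
    have h : x ∈ locAtCentre Am.toSubring O := le_locAtCentre Am.toSubring O hx
    rw [← hT] at h
    exact h
  have hTO : (tower O A m₀).toSubring ≤ O.toSubring := by
    rw [hT]
    exact locAtCentre_le hAmO
  -- (2) the centre has height `h`; `dim Am = N = tr.deg_k K`
  obtain ⟨N, hN, hNtr⟩ := exists_ringKrullDim_eq_and_trdeg_eq k ↥Am
  have hht : (centreIdeal Am O hAmO).height = (h : ℕ∞) := by
    have h1 := ringKrullDim_tower_eq_height_centre O A m₀ hAmO hT
    rw [hdim] at h1
    have h2 : (((centreIdeal Am O hAmO).height : ℕ∞) : WithBot ℕ∞) = ((h : ℕ∞) : WithBot ℕ∞) := h1.symm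
    exact_mod_cast h2
  -- (3) the intermediate field `F ⊆ T`, `tr.deg_k F ≥ r`, `r + h = N`
  obtain ⟨F, hFT', r, hrN, hrle⟩ :=
    exists_intermediateField_le_locAtCentre O Am hAmfg hAmO (h := h) hN hht
  have hFT : (F : Set K) ⊆ tower O A m₀ := fun x hx => by
    have h : x ∈ locAtCentre Am.toSubring O := hFT' hx
    rw [← hT] at h
    exact h
  have hkF : ∀ c : ↥F, algebraMap (↥F) K c ∈ O := fun c => hTO (hFT c.2)
  -- (4) the finitely generated `F`-model `A' = F[Am] ⊆ T`
  obtain ⟨u, hu⟩ := hAmfg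
  set A' : Subalgebra ↥F K := Algebra.adjoin ↥F (u : Set K) with hA'
  have hA'fg : A'.FG := ⟨u, rfl⟩
  have hAmA' : (Am : Set K) ⊆ A' := by
    rw [← hu]
    have hle : Algebra.adjoin k (u : Set K) ≤ A'.restrictScalars k :=
      Algebra.adjoin_le (Algebra.subset_adjoin (R := ↥F) (s := (u : Set K)))
    exact fun x hx => hle hx
  -- `T` as an `F`-subalgebra
  let TF : Subalgebra ↥F K :=
    { carrier := (tower O A m₀ : Set K)
      mul_mem' := fun ha hb => (tower O A m₀).mul_mem ha hb
      one_mem' := (tower O A m₀).one_mem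
      add_mem' := fun ha hb => (tower O A m₀).add_mem ha hb
      zero_mem' := (tower O A m₀).zero_mem
      algebraMap_mem' := fun c => hFT c.2 }
  have hA'T : A' ≤ TF := by
    refine Algebra.adjoin_le fun x hx => ?_
    have hxAm : x ∈ Am := by rw [← hu]; exact Algebra.subset_adjoin hx
    exact hAmT hxAm
  have hA'O : A'.toSubring ≤ O.toSubring := fun x hx => hTO (hA'T hx)
  have hA'fr : IsFractionRing ↥A' K := by
    haveI : FaithfulSMul ↥A' K := (faithfulSMul_iff_algebraMap_injective _ _).mpr Subtype.val_injective
    apply IsFractionRing.of_field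
    intro z
    obtain ⟨x, y, -, rfl⟩ := IsFractionRing.div_surjective (A := ↥Am) z
    exact ⟨⟨x, hAmA' x.2⟩, ⟨y, hAmA' y.2⟩, rfl⟩
  -- `(A')_{centre} = T`
  have hTA' : (tower O A m₀).toSubring = locAtCentre A'.toSubring O := by
    apply le_antisymm
    · rw [hT]
      exact locAtCentre_mono O (fun x hx => hAmA' hx)
    · calc locAtCentre A'.toSubring O ≤ locAtCentre (tower O A m₀).toSubring O :=
            locAtCentre_mono O (fun x hx => hA'T hx)
        _ = (tower O A m₀).toSubring := by rw [hT, locAtCentre_locAtCentre]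
  -- (5) `dim A' = h`
  haveI : Algebra.FiniteType (↥F) ↥A' := A'.fg_iff_finiteType.mp hA'fg
  obtain ⟨M, hM, hMtr⟩ := exists_ringKrullDim_eq_and_trdeg_eq (↥F) ↥A'
  have hdimA' : ringKrullDim ↥A' = h := by
    -- `h = ht (centre on A') ≤ dim A'`
    have hge : (h : WithBot ℕ∞) ≤ ringKrullDim ↥A' := by
      have h1 := ringKrullDim_tower_eq_height_centre O A m₀ (Am := A'.restrictScalars k) hA'O hTA'
      rw [hdim] at h1
      rw [h1]
      exact Ideal.height_le_ringKrullDim_of_isPrime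
    -- `dim A' = tr.deg_F K ≤ N - r = h` by additivity of transcendence degrees along `k ⊆ F ⊆ K`
    haveI : IsFractionRing ↥A' K := hA'fr
    have htrFK : Algebra.trdeg (↥F) K = M := by rw [trdeg_eq_trdeg_of_isFractionRing A', hMtr]
    have htrkK : Algebra.trdeg k K = N := by rw [trdeg_eq_trdeg_of_isFractionRing Am, hNtr]
    haveI : FaithfulSMul k ↥F := (faithfulSMul_iff_algebraMap_injective _ _).mpr (algebraMap k ↥F).injective
    haveI : FaithfulSMul (↥F) K := (faithfulSMul_iff_algebraMap_injective _ _).mpr (algebraMap (↥F) K).injective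
    have hadd := trdeg_add_eq k (↥F) (A := K)
    rw [htrFK, htrkK] at hadd
    -- `trdeg k F` is then a natural number `c` with `c + M = N` and `r ≤ c`
    have hcle : Algebra.trdeg k ↥F ≤ N := by rw [← hadd]; exact self_le_add_right _ _
    obtain ⟨c, hc⟩ : ∃ c : ℕ, Algebra.trdeg k ↥F = c := by
      have hlt : Algebra.trdeg k ↥F < Cardinal.aleph0 := lt_of_le_of_lt hcle (Cardinal.natCast_lt_aleph0 (n := N))
      exact Cardinal.lt_aleph0.mp hlt
    rw [hc] at hadd hrle
    have hcM : c + M = N := by exact_mod_cast hadd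
    have hrc : r ≤ c := by exact_mod_cast hrle
    have hMh : M ≤ h := by omega
    have hleh : ringKrullDim ↥A' ≤ h := by rw [hM]; exact_mod_cast hMh
    exact le_antisymm hleh hge
  -- (6) the towers: `tower_F O A' n = tower_F O (loc O A') n` has the ring of `tower_k O T n = T_(m₀+n)`
  have hloc : (tower O A m₀).toSubring = (tower O A' 0).toSubring := by
    rw [tower_zero, loc_eq_locAt]
    change (tower O A m₀).toSubring = (loc O A').toSubring
    rw [hTA']
    exact (stub_locEq O A' hA'O).symm
  refine ⟨F, A', hkF, hA'fg, hA'fr, hA'O, hdimA', fun n => ⟨?_, ?_⟩⟩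
  · rw [← tower_tower O A hk hAO m₀ n, ← Nat.zero_add n, ← tower_tower O A' hkF hA'O 0 n, Nat.zero_add]
    exact GroundChange.tower_toSubring_eq F O (tower O A m₀) (tower O A' 0) hloc hFT n
  · rw [← tower_tower O A hk hAO m₀ n, ← Nat.zero_add n, ← tower_tower O A' hkF hA'O 0 n, Nat.zero_add]
    exact GroundChange.isRegularLocalRing_tower_iff F O (tower O A m₀) (tower O A' 0) hloc hFT n


end Summit.ResolutionOfSingularities.ResolutionOfSingularities.Theorems.NoZeno.Birth.Reground

end
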